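import Summits.NavierStokesRegularity.NavierStokesRegularity.Theorems.RellichScarSymmetricScarExistsApexRieszPressureLemmas
import Summits.NavierStokesRegularity.NavierStokesRegularity.Theorems.AdaptedFrequencyTangentFlowTransferKernelCalculusGlobal
import Literature.Analysis.FluidPDE.NormalisedPressureFarFieldHessian
import Literature.Analysis.FluidPDE.SpaceTimeMixedPartials
import Literature.Analysis.FluidPDE.SpaceTimeCalculus
import Literature.Analysis.FluidPDE.TaoEnstrophyLocalisation
import Summits.NavierStokesRegularity.NavierStokesRegularity.Theorems.AdaptedFrequencyAdaptedFrequencyConvergesStubKernelCalculus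

/-! # Second-order kernel calculus, tools — crux stmt-NavierStokesRegularity-10493
(`AdaptedFrequency.AdaptedFrequencyConverges`), line unsteadiness-squeeze, stub `stub_enstrophyC2`

Helper file 1/2 (`--supports stmt-NavierStokesRegularity-10493`; theorems only) for the registered
stub `stub_enstrophyC2` (`H = adaptedEnstrophy u G ∈ C²` near `T`). The second derivative of
`H(t) = ∫ ‖curl u(t)‖² G(t)` is the first variation of `H′(t) = ∫ q G(t)` with the density
`q = 2⟪ω, (∇u)ω⟫ − 2ν|∇ω|²_F`, and the transport-free first variation of the tree
(`hasDerivAt_integral_mul_kernel_of_bounds`) needs uniform bounds on `q, ∇q, Δq` and on the TIME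
derivative `∂ₜq`, i.e. on `∂ₜ∇u = ∇∂ₜu = ∇(νΔu − (u·∇)u − ∇p)` — the pressure Hessian. This file
supplies the elementary inputs:

* `enstrophyC2_norm_iteratedFDeriv_two_pressurePotential_le` — a sup bound for the Hessian of the
  Riesz pressure `Q[v] = −Q₁[v] − Q₂[v]` (`pressurePotential`) of a smooth field with bounded
  derivatives and finite energy: near part through the landed `apexRieszPressure_nearBounds`
  (truncated Newtonian kernel against `D²` of the quadratic source), far part by differentiating
  twice under the integral sign (`fderiv_fderiv_farPotential_apply_apply`, `‖D⁴Γ∞‖ ≤ M₄`);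
* `enstrophyC2_hasDerivAt_fderiv_slice` — on an open time set, `∂ₜ (∇w)(t, x) = ∇(∂ₜw(t, ·))(x)`
  for a jointly smooth field (the tree's exchange lemma
  `IsSmoothSpaceTimeOn.timeDerivWithin_fderiv_slice_apply_of_uniqueDiffOn`, operator form);
* `enstrophyC2_exists_bound_iteratedFDeriv` — derivatives of orders `≤ 2` of a smooth function on
  a proper space are bounded on balls (compactness), and `enstrophyC2_contDiff_density` — the
  density `(ω, A, B) ↦ 2⟪ω, Aω⟫ − 2ν|B|²_F` is smooth: together they bound `q = Φ ∘ (ω, ∇u, ∇ω)`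
  and its derivatives without any explicit differentiation of the density;
* `enstrophyC2_slab_bounds`, `enstrophyC2_energy`, `enstrophyC2_gaussian_majorant` — the
  a priori inputs on a window `(a, b) ⋐ (0, T)`: all spatial derivatives of `u` of orders `≤ 4`
  are bounded (Tao 2013, Cor. 11.1 on the closed slab `[0, b]`, `tao2011_hasBoundedSobolevNormsOn_holds`,
  and Sobolev imbedding), the energy is finite (Leray–Hopf), and the Gaussian-comparable kernel
  is dominated on the window by one integrable Gaussian;
* Leibniz-type bounds (`enstrophyC2_norm_iteratedFDeriv_clm_apply_le`,
  `enstrophyC2_norm_iteratedFDeriv_curl_le`), the chain-rule bound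
  `enstrophyC2_abs_deriv_comp_le`, and parametric continuity of `s ↦ ∫ g(s) G(s)` under a fixed
  integrable dominator (`enstrophyC2_continuousOn_integral_mul`).
-/

noncomputable section

open scoped Topology InnerProductSpace RealInnerProductSpace Laplacian ContDiff
open Literature.Analysis.FluidPDE Set Filter MeasureTheory Function Metric

namespace Summit.NavierStokesRegularity.NavierStokesRegularity.Theorems.AdaptedFrequencyConverges.UnsteadinessSqueeze

open Summit.NavierStokesRegularity.NavierStokesRegularity.Theorems.SymmetricScarExists.LogtimeBernoulli
  (sum_choose_mul_le norm_iteratedFDeriv_pressureSource_le apexRieszPressure_nearBounds)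
open Literature.Analysis.FluidPDE.PineauVicol2026 (newtonNearMass newtonNearMass_nonneg)

-- nested operator types `ℝ³ →L[ℝ] ℝ³ →L[ℝ] ℝ³ →L[ℝ] ℝ³ →L[ℝ] ℝ`
set_option maxSynthPendingDepth 4

/-! ### Leibniz-type bounds -/

/-- **Leibniz bound for the evaluation pairing**: if `‖Dⁱf(x)‖, ‖Dⁱg(x)‖ ≤ B` for `i ≤ n`, then
`‖Dⁿ(y ↦ f(y) (g y))(x)‖ ≤ 2ⁿ B²` (Mathlib's `norm_iteratedFDeriv_clm_apply` and `Σᵢ C(n,i) = 2ⁿ`). -/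
theorem enstrophyC2_norm_iteratedFDeriv_clm_apply_le {F G : Type*} [NormedAddCommGroup F]
    [NormedSpace ℝ F] [NormedAddCommGroup G] [NormedSpace ℝ G]
    {f : EuclideanSpace ℝ (Fin 3) → F →L[ℝ] G} {g : EuclideanSpace ℝ (Fin 3) → F}
    (hf : ContDiff ℝ ∞ f) (hg : ContDiff ℝ ∞ g) {n : ℕ} {B : ℝ} (hB0 : 0 ≤ B)
    {x : EuclideanSpace ℝ (Fin 3)}
    (hBf : ∀ i ≤ n, ‖iteratedFDeriv ℝ i f x‖ ≤ B) (hBg : ∀ i ≤ n, ‖iteratedFDeriv ℝ i g x‖ ≤ B) :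
    ‖iteratedFDeriv ℝ n (fun y => f y (g y)) x‖ ≤ 2 ^ n * B ^ 2 := by
  refine (norm_iteratedFDeriv_clm_apply hf hg x (n := n) (mod_cast le_top)).trans ?_
  exact sum_choose_mul_le hB0 (fun _ => norm_nonneg _)
    (fun i hi => hBf i (Nat.lt_succ_iff.mp (Finset.mem_range.mp hi)))
    (fun i _ => hBg (n - i) (Nat.sub_le n i))

/-- **Derivatives of the curl**: `‖Dᵏ(curl v)(x)‖ ≤ ‖curlCLM‖ ‖Dᵏ⁺¹v(x)‖` (`curl = curlCLM ∘ D`). -/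
theorem enstrophyC2_norm_iteratedFDeriv_curl_le
    {v : EuclideanSpace ℝ (Fin 3) → EuclideanSpace ℝ (Fin 3)} (hv : ContDiff ℝ ∞ v) (k : ℕ)
    (x : EuclideanSpace ℝ (Fin 3)) :
    ‖iteratedFDeriv ℝ k (curl v) x‖ ≤ ‖curlCLM‖ * ‖iteratedFDeriv ℝ (k + 1) v x‖ := by
  rw [curl_eq_curlCLM_comp]
  have hf : ContDiff ℝ ∞ (fderiv ℝ v) := hv.fderiv_right (m := ∞) le_rfl
  refine (curlCLM.norm_iteratedFDeriv_comp_left hf.contDiffAt (mod_cast le_top)).trans ?_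
  rw [norm_iteratedFDeriv_fderiv]

/-- **Chain-rule bound along a time line**: for `Φ` smooth and `J` differentiable at `s`,
`|d/dr Φ(J r)|_{r=s} ≤ C Z` whenever `‖DΦ(J s)‖ ≤ C` and `‖J′(s)‖ ≤ Z`. -/
theorem enstrophyC2_abs_deriv_comp_le {V : Type*} [NormedAddCommGroup V] [NormedSpace ℝ V]
    {Φ : V → ℝ} (hΦ : ContDiff ℝ ∞ Φ) {J : ℝ → V} {J' : V} {s : ℝ} (hJ : HasDerivAt J J' s)
    {C Z : ℝ} (hC : ‖iteratedFDeriv ℝ 1 Φ (J s)‖ ≤ C) (hZ : ‖J'‖ ≤ Z) :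
    |deriv (fun r => Φ (J r)) s| ≤ C * Z := by
  have hd : HasDerivAt (fun r => Φ (J r)) (fderiv ℝ Φ (J s) J') s :=
    ((hΦ.differentiable (by simp)) (J s)).hasFDerivAt.comp_hasDerivAt s hJ
  rw [hd.deriv, ← Real.norm_eq_abs]
  rw [norm_iteratedFDeriv_one] at hC
  have hC0 : 0 ≤ C := (norm_nonneg _).trans hC
  exact (ContinuousLinearMap.le_opNorm _ _).trans (mul_le_mul hC hZ (norm_nonneg _) hC0)

/-! ### Smooth functions of bounded jets -/

/-- **Derivatives of orders `≤ 2` of a smooth function on a proper space are bounded on balls**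
(continuity of `DⁱΦ` on the compact closed ball). -/
theorem enstrophyC2_exists_bound_iteratedFDeriv {V : Type*} [NormedAddCommGroup V]
    [NormedSpace ℝ V] [ProperSpace V] {Φ : V → ℝ} (hΦ : ContDiff ℝ ∞ Φ) (R : ℝ) :
    ∃ C, 0 ≤ C ∧ ∀ i ≤ 2, ∀ v : V, ‖v‖ ≤ R → ‖iteratedFDeriv ℝ i Φ v‖ ≤ C := by
  have hK : IsCompact (closedBall (0 : V) R) := isCompact_closedBall 0 R
  have hb : ∀ i : ℕ, ∃ C, ∀ v ∈ closedBall (0 : V) R, ‖iteratedFDeriv ℝ i Φ v‖ ≤ C := fun i =>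
    hK.exists_bound_of_continuousOn
      ((hΦ.continuous_iteratedFDeriv (m := i) (mod_cast le_top)).continuousOn)
  obtain ⟨C₀, h₀⟩ := hb 0
  obtain ⟨C₁, h₁⟩ := hb 1
  obtain ⟨C₂, h₂⟩ := hb 2
  refine ⟨max (max C₀ 0) (max C₁ C₂), (le_max_right _ _).trans (le_max_left _ _),
    fun i hi v hv => ?_⟩
  have hv' : v ∈ closedBall (0 : V) R := mem_closedBall_zero_iff.2 hv
  interval_cases i
  · exact (h₀ v hv').trans ((le_max_left _ _).trans (le_max_left _ _))
  · exact (h₁ v hv').trans ((le_max_left _ _).trans (le_max_right _ _))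
  · exact (h₂ v hv').trans ((le_max_right _ _).trans (le_max_right _ _))

/-- **The enstrophy-production density is a smooth function of the jet**:
`(ω, A, B) ↦ 2⟪ω, Aω⟫ − 2ν|B|²_F` is `C^∞` on `ℝ³ × (ℝ³ →L ℝ³) × (ℝ³ →L ℝ³)`
(`|B|²_F = Σᵢ ‖B eᵢ‖²`). -/
theorem enstrophyC2_contDiff_density (ν : ℝ) :
    ContDiff ℝ ∞ (fun v : EuclideanSpace ℝ (Fin 3) ×
        ((EuclideanSpace ℝ (Fin 3) →L[ℝ] EuclideanSpace ℝ (Fin 3)) ×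
          (EuclideanSpace ℝ (Fin 3) →L[ℝ] EuclideanSpace ℝ (Fin 3))) =>
      2 * ⟪v.1, v.2.1 v.1⟫ - 2 * ν * frobeniusNormSq v.2.2) := by
  have h1 : ContDiff ℝ ∞ fun v : EuclideanSpace ℝ (Fin 3) ×
      ((EuclideanSpace ℝ (Fin 3) →L[ℝ] EuclideanSpace ℝ (Fin 3)) ×
        (EuclideanSpace ℝ (Fin 3) →L[ℝ] EuclideanSpace ℝ (Fin 3))) => v.1 := contDiff_fst
  have h2 : ContDiff ℝ ∞ fun v : EuclideanSpace ℝ (Fin 3) ×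
      ((EuclideanSpace ℝ (Fin 3) →L[ℝ] EuclideanSpace ℝ (Fin 3)) ×
        (EuclideanSpace ℝ (Fin 3) →L[ℝ] EuclideanSpace ℝ (Fin 3))) => v.2.1 :=
    contDiff_fst.comp contDiff_snd
  have h3 : ContDiff ℝ ∞ fun v : EuclideanSpace ℝ (Fin 3) ×
      ((EuclideanSpace ℝ (Fin 3) →L[ℝ] EuclideanSpace ℝ (Fin 3)) ×
        (EuclideanSpace ℝ (Fin 3) →L[ℝ] EuclideanSpace ℝ (Fin 3))) => v.2.2 :=
    contDiff_snd.comp contDiff_snd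
  have h4 := h2.clm_apply h1
  have h5 := h1.inner ℝ h4
  have h6 : ContDiff ℝ ∞ fun v : EuclideanSpace ℝ (Fin 3) ×
      ((EuclideanSpace ℝ (Fin 3) →L[ℝ] EuclideanSpace ℝ (Fin 3)) ×
        (EuclideanSpace ℝ (Fin 3) →L[ℝ] EuclideanSpace ℝ (Fin 3))) => frobeniusNormSq v.2.2 := by
    unfold frobeniusNormSq
    refine ContDiff.sum fun i _ => ?_
    exact (h3.clm_apply contDiff_const).norm_sq ℝ
  exact (contDiff_const.mul h5).sub (contDiff_const.mul h6)

/-! ### Exchange of `∂ₜ` and `∇` on open time sets -/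

/-- **`∂ₜ∇w = ∇∂ₜw` in operator form, on an open time set.** For a jointly smooth field `w` on
`S × ℝ³`, `S` open, `s ∈ S`, and `R = ∂ₜw(s, ·)`, the operator-valued time line
`r ↦ D(w r)(x)` has derivative `D R (x)` at `s` (the tree's exchange lemma
`IsSmoothSpaceTimeOn.timeDerivWithin_fderiv_slice_apply_of_uniqueDiffOn`, tested on vectors). -/
theorem enstrophyC2_hasDerivAt_fderiv_slice {F : Type*} [NormedAddCommGroup F] [NormedSpace ℝ F]
    {S : Set ℝ} (hS : IsOpen S) {w : ℝ → EuclideanSpace ℝ (Fin 3) → F}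
    (hw : IsSmoothSpaceTimeOn S w) {s : ℝ} (hs : s ∈ S) {R : EuclideanSpace ℝ (Fin 3) → F}
    (hR : ∀ y, deriv (fun r => w r y) s = R y) (x : EuclideanSpace ℝ (Fin 3)) :
    HasDerivAt (fun r => fderiv ℝ (w r) x) (fderiv ℝ R x) s := by
  have hU : UniqueDiffOn ℝ S := hS.uniqueDiffOn
  have hline := (hw.fderiv_slice hU).hasDerivAt_timeLine hS hs x
  have hT : timeDerivWithin S w s = R := by
    funext y
    rw [timeDerivWithin_eq_deriv hS hs w y, hR y]
  have heq : deriv (fun r => fderiv ℝ (w r) x) s = fderiv ℝ R x := by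
    ext v
    have h1 := (hline.clm_apply (hasDerivAt_const s v)).deriv
    simp only [map_zero, add_zero] at h1
    have h2 := timeDerivWithin_eq_deriv hS hs (fun r y => fderiv ℝ (w r) y v) x
    rw [← h1, ← h2, hw.timeDerivWithin_fderiv_slice_apply_of_uniqueDiffOn hU hs x v, hT]
  rw [← heq]
  exact hline

/-! ### Parametric continuity under a fixed dominator -/

/-- **Continuity of `s ↦ ∫ g(s, x) G(s, x) dx` on `S`** for a jointly smooth bounded `g`, a jointly
`C²` nonnegative kernel `G` dominated on `S` by one integrable `Φ₀` (dominated convergence). -/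
theorem enstrophyC2_continuousOn_integral_mul {S : Set ℝ}
    {g G : ℝ → EuclideanSpace ℝ (Fin 3) → ℝ} (hg : IsSmoothSpaceTimeOn S g)
    (hG : ContDiffOn ℝ 2 (uncurry G) (S ×ˢ univ)) (hG0 : ∀ s ∈ S, ∀ x, 0 ≤ G s x)
    {Φ₀ : EuclideanSpace ℝ (Fin 3) → ℝ} (hΦ₀ : Integrable Φ₀)
    (hdom : ∀ s ∈ S, ∀ x, G s x ≤ Φ₀ x) {A : ℝ} (hA : ∀ s ∈ S, ∀ x, |g s x| ≤ A) :
    ContinuousOn (fun s => ∫ x, g s x * G s x) S := by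
  have hGc : ∀ s ∈ S, Continuous (G s) := fun s hs =>
    (contDiff_slice_of_contDiffOn_prod_univ hG hs).continuous
  have hgc : ∀ s ∈ S, Continuous (g s) := fun s hs => (hg.contDiff_slice hs).continuous
  have hA' : ∀ s ∈ S, ∀ x, |g s x * G s x| ≤ A * Φ₀ x := fun s hs x => by
    rw [abs_mul, abs_of_nonneg (hG0 s hs x)]
    exact mul_le_mul (hA s hs x) (hdom s hs x) (hG0 s hs x) ((abs_nonneg _).trans (hA s hs x))
  refine continuousOn_of_dominated (bound := fun x => A * Φ₀ x) ?_ ?_ (hΦ₀.const_mul _) ?_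
  · intro s hs
    exact ((hgc s hs).mul (hGc s hs)).aestronglyMeasurable
  · intro s hs
    exact Eventually.of_forall fun x => by rw [Real.norm_eq_abs]; exact hA' s hs x
  · refine Eventually.of_forall fun x => ?_
    have h1 : ContinuousOn (uncurry g) (S ×ˢ univ) := hg.continuousOn
    have h2 : ContinuousOn (uncurry G) (S ×ˢ univ) := hG.continuousOn
    have h3 : ContinuousOn (fun s : ℝ => ((s, x) : ℝ × EuclideanSpace ℝ (Fin 3))) S :=
      (continuous_id.prodMk continuous_const).continuousOn
    have hmaps : MapsTo (fun s : ℝ => ((s, x) : ℝ × EuclideanSpace ℝ (Fin 3))) S (S ×ˢ univ) :=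
      fun s hs => ⟨hs, mem_univ x⟩
    exact (h1.comp h3 hmaps).mul (h2.comp h3 hmaps)


/-! ### A priori inputs on a window: slab bounds, energy, Gaussian majorant -/

/-- **All spatial derivatives of orders `≤ 4` are bounded on `(a, b) × ℝ³`, `0 ≤ a`, `b < T`**,
for a classical solution on `[0, T)` which is Leray–Hopf from a rapidly decaying datum (Tao 2013,
Cor. 11.1 on the closed slab `[0, b]`, `tao2011_hasBoundedSobolevNormsOn_holds`, and the Sobolev
imbedding `exists_forall_norm_iteratedFDeriv_le_of_hasBoundedSobolevNormsOn`). -/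
theorem enstrophyC2_slab_bounds {ν T a b : ℝ}
    {u : ℝ → EuclideanSpace ℝ (Fin 3) → EuclideanSpace ℝ (Fin 3)}
    {p : ℝ → EuclideanSpace ℝ (Fin 3) → ℝ} (hν : 0 < ν)
    (hcl : IsClassicalNSSolutionOn (Ico 0 T) ν 0 u p) (hLH : IsLerayHopfOn T ν 0 (u 0) u)
    (hdec : HasRapidSpatialDecay (u 0)) (h0a : 0 ≤ a) (hb0 : 0 < b) (hbT : b < T) :
    ∃ K : ℝ, ∀ k ≤ 4, ∀ s ∈ Ioo a b, ∀ x, ‖iteratedFDeriv ℝ k (u s) x‖ ≤ K := by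
  have hcl' : IsClassicalNSSolutionOn (Icc 0 b) ν 0 u p :=
    hcl.mono (Icc_subset_Ico_right hbT) (uniqueDiffOn_Icc hb0)
  have hE : ∃ C : NNReal, ∀ s ∈ Icc 0 b, ∫⁻ x, ‖u s x‖ₑ ^ 2 ≤ C :=
    ⟨(2 * VectorCalculus.kineticEnergy (u 0)).toNNReal, fun s hs =>
      hLH.lintegral_enorm_sq_le hν.le ⟨hs.1, hs.2.trans hbT.le⟩⟩
  have hH : HasBoundedSobolevNormsOn (Icc 0 b) u :=
    tao2011_hasBoundedSobolevNormsOn_holds hν hb0 hcl' hE hdec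
  have hsm : ∀ s ∈ Icc 0 b, ContDiff ℝ ∞ (u s) := fun s hs => hcl'.contDiff_velocity hs
  obtain ⟨K₀, hK₀⟩ := exists_forall_norm_iteratedFDeriv_le_of_hasBoundedSobolevNormsOn hsm hH 0
  obtain ⟨K₁, hK₁⟩ := exists_forall_norm_iteratedFDeriv_le_of_hasBoundedSobolevNormsOn hsm hH 1
  obtain ⟨K₂, hK₂⟩ := exists_forall_norm_iteratedFDeriv_le_of_hasBoundedSobolevNormsOn hsm hH 2
  obtain ⟨K₃, hK₃⟩ := exists_forall_norm_iteratedFDeriv_le_of_hasBoundedSobolevNormsOn hsm hH 3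
  obtain ⟨K₄, hK₄⟩ := exists_forall_norm_iteratedFDeriv_le_of_hasBoundedSobolevNormsOn hsm hH 4
  have hIoo : Ioo a b ⊆ Icc 0 b := fun s hs => ⟨h0a.trans hs.1.le, hs.2.le⟩
  refine ⟨max (max (max K₀ K₁) (max K₂ K₃)) K₄, fun k hk s hs x => ?_⟩
  interval_cases k
  · exact (hK₀ s (hIoo hs) x).trans (le_trans (le_trans (le_max_left _ _) (le_max_left _ _))
      (le_max_left _ _))
  · exact (hK₁ s (hIoo hs) x).trans (le_trans (le_trans (le_max_right _ _) (le_max_left _ _))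
      (le_max_left _ _))
  · exact (hK₂ s (hIoo hs) x).trans (le_trans (le_trans (le_max_left _ _) (le_max_right _ _))
      (le_max_left _ _))
  · exact (hK₃ s (hIoo hs) x).trans (le_trans (le_trans (le_max_right _ _) (le_max_right _ _))
      (le_max_left _ _))
  · exact (hK₄ s (hIoo hs) x).trans (le_max_right _ _)

/-- **Finite energy on the closed slab `[0, b]`, `b ≤ T`** for a classical solution on `[0, T)`
which is Leray–Hopf (energy inequality from `s = 0`), in the real form consumed by the pressure
normalisation lemma. -/
theorem enstrophyC2_energy {ν T b : ℝ}
    {u : ℝ → EuclideanSpace ℝ (Fin 3) → EuclideanSpace ℝ (Fin 3)}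
    {p : ℝ → EuclideanSpace ℝ (Fin 3) → ℝ} (hν : 0 < ν)
    (hcl : IsClassicalNSSolutionOn (Ico 0 T) ν 0 u p) (hLH : IsLerayHopfOn T ν 0 (u 0) u)
    (hbT : b < T) :
    ∃ E₀ : ℝ, 0 ≤ E₀ ∧ (∀ s ∈ Icc 0 b, Integrable fun y => ‖u s y‖ ^ 2) ∧
      ∀ s ∈ Icc 0 b, ∫ y, ‖u s y‖ ^ 2 ≤ E₀ := by
  obtain ⟨Cₑ, hCₑ⟩ : ∃ C : NNReal, ∀ s ∈ Icc 0 b, ∫⁻ x, ‖u s x‖ₑ ^ 2 ≤ C :=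
    ⟨(2 * VectorCalculus.kineticEnergy (u 0)).toNNReal, fun s hs =>
      hLH.lintegral_enorm_sq_le hν.le ⟨hs.1, hs.2.trans hbT.le⟩⟩
  have hsm : ∀ s ∈ Icc 0 b, ContDiff ℝ ∞ (u s) := fun s hs =>
    hcl.contDiff_velocity ⟨hs.1, hs.2.trans_lt hbT⟩
  have hint : ∀ s ∈ Icc 0 b, Integrable fun y => ‖u s y‖ ^ 2 := fun s hs =>
    integrable_sq_of_lintegral_enorm_sq_lt_top (hsm s hs).continuous
      ((hCₑ s hs).trans_lt ENNReal.coe_lt_top)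
  refine ⟨Cₑ, NNReal.coe_nonneg Cₑ, hint, fun s hs => ?_⟩
  have h1 := hCₑ s hs
  rw [← ofReal_integral_norm_sq_eq_lintegral (hint s hs)] at h1
  have h2 := (ENNReal.ofReal_le_iff_le_toReal ENNReal.coe_ne_top).1 h1
  simpa using h2

/-- **One integrable Gaussian dominating a Gaussian-comparable kernel on a window `(a, b)`,
`b < T`**: `G(s, x) ≤ C₁ (T − b)^{-3/2} exp(−‖x − x₀‖²/(C₂(T − a)))` for `s ∈ (a, b) ⊆ S`. -/
theorem enstrophyC2_gaussian_majorant {S : Set ℝ} {T a b : ℝ} {x₀ : EuclideanSpace ℝ (Fin 3)}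
    {G : ℝ → EuclideanSpace ℝ (Fin 3) → ℝ} (hcmp : IsGaussianComparable G S T x₀)
    (hS : Ioo a b ⊆ S) (hab : a < b) (hbT : b < T) :
    ∃ M : EuclideanSpace ℝ (Fin 3) → ℝ, Integrable M ∧ ∀ s ∈ Ioo a b, ∀ x, G s x ≤ M x := by
  obtain ⟨c₁, c₂, C₁, C₂, -, -, hC₁, hC₂, hcomp⟩ := hcmp
  have hTa : 0 < T - a := by linarith
  have hTb : 0 < T - b := by linarith
  refine ⟨fun x => C₁ * (T - b) ^ (-(Module.finrank ℝ (EuclideanSpace ℝ (Fin 3)) : ℝ) / 2) *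
      Real.exp (-(1 / (C₂ * (T - a))) * ‖x - x₀‖ ^ 2), ?_, fun s hs x => ?_⟩
  · exact ((Literature.Analysis.UnboundedOperators.integrable_gaussian_of_pos
      (by positivity : 0 < 1 / (C₂ * (T - a)))).comp_sub_right x₀).const_mul _
  refine ((hcomp s (hS hs) x).2).trans ?_
  have hTs : 0 < T - s := by linarith [hs.2]
  have h1 : (T - s) ^ (-(Module.finrank ℝ (EuclideanSpace ℝ (Fin 3)) : ℝ) / 2) ≤
      (T - b) ^ (-(Module.finrank ℝ (EuclideanSpace ℝ (Fin 3)) : ℝ) / 2) :=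
    Real.rpow_le_rpow_of_nonpos hTb (by linarith [hs.2]) (by
      rw [finrank_euclideanSpace_fin]; norm_num)
  have h2 : Real.exp (-(‖x - x₀‖ ^ 2) / (C₂ * (T - s))) ≤
      Real.exp (-(1 / (C₂ * (T - a))) * ‖x - x₀‖ ^ 2) := by
    rw [Real.exp_le_exp, neg_div, show -(1 / (C₂ * (T - a))) * ‖x - x₀‖ ^ 2 =
      -(‖x - x₀‖ ^ 2 / (C₂ * (T - a))) by ring, neg_le_neg_iff]
    exact div_le_div_of_nonneg_left (sq_nonneg _) (by positivity)
      (mul_le_mul_of_nonneg_left (by linarith [hs.1]) hC₂.le)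
  have h0 : 0 ≤ C₁ * (T - s) ^ (-(Module.finrank ℝ (EuclideanSpace ℝ (Fin 3)) : ℝ) / 2) :=
    mul_nonneg hC₁.le (Real.rpow_nonneg hTs.le _)
  calc C₁ * (T - s) ^ (-(Module.finrank ℝ (EuclideanSpace ℝ (Fin 3)) : ℝ) / 2) *
        Real.exp (-(‖x - x₀‖ ^ 2) / (C₂ * (T - s)))
      ≤ C₁ * (T - s) ^ (-(Module.finrank ℝ (EuclideanSpace ℝ (Fin 3)) : ℝ) / 2) *
          Real.exp (-(1 / (C₂ * (T - a))) * ‖x - x₀‖ ^ 2) :=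
        mul_le_mul_of_nonneg_left h2 h0
    _ ≤ C₁ * (T - b) ^ (-(Module.finrank ℝ (EuclideanSpace ℝ (Fin 3)) : ℝ) / 2) *
          Real.exp (-(1 / (C₂ * (T - a))) * ‖x - x₀‖ ^ 2) := by
        gcongr

/-! ### The Hessian of the Riesz pressure of a smooth finite-energy field -/

/-- **Sup bound for the Hessian of the Riesz pressure.** For a smooth field `v` on `ℝ³` with
`‖Dʲv‖ ≤ B` (`j ≤ 4`) and `∫ |v|² ≤ E₀`, the pressure potential
`Q[v] = −Q₁[v] − Q₂[v]` (`pressurePotential`, `= −Δ⁻¹∂ᵢ∂ⱼ(vᵢvⱼ)`) has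
`‖D²Q[v](x)‖ ≤ N₁ · T(1+T) 2³ B² + M₄ E₀` for all `x`, where `N₁ = ∫|Γ₀|`, `T = ‖tr‖` and
`‖D⁴Γ∞‖ ≤ M₄`: near part by `apexRieszPressure_nearBounds` and the Leibniz bounds for the source
`∂ᵢ∂ⱼ(vᵢvⱼ)`, far part by `D²Q₂[v](x)(a,b) = ∫ D⁴Γ∞(x − y)(a, b, v y, v y) dy`. -/
theorem enstrophyC2_norm_iteratedFDeriv_two_pressurePotential_le
    {v : EuclideanSpace ℝ (Fin 3) → EuclideanSpace ℝ (Fin 3)} (hv : ContDiff ℝ ∞ v)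
    (hL2 : Integrable fun y => ‖v y‖ ^ 2) {B E₀ M₄ : ℝ} (hB0 : 0 ≤ B)
    (hB : ∀ j ≤ 4, ∀ y, ‖iteratedFDeriv ℝ j v y‖ ≤ B) (hE : ∫ y, ‖v y‖ ^ 2 ≤ E₀)
    (hM₄ : ∀ z, ‖fderiv ℝ (fderiv ℝ (fderiv ℝ (fderiv ℝ (newtonFar (1 : ℝ) 2)))) z‖ ≤ M₄)
    (x : EuclideanSpace ℝ (Fin 3)) :
    ‖iteratedFDeriv ℝ 2 (pressurePotential v) x‖ ≤
      newtonNearMass * (‖(traceCLM : (EuclideanSpace ℝ (Fin 3) →L[ℝ] EuclideanSpace ℝ (Fin 3)) →L[ℝ] ℝ)‖ *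
        ((1 + ‖(traceCLM : (EuclideanSpace ℝ (Fin 3) →L[ℝ] EuclideanSpace ℝ (Fin 3)) →L[ℝ] ℝ)‖) *
          (2 ^ 3 * B ^ 2))) + M₄ * E₀ := by
  set Tn : ℝ := ‖(traceCLM : (EuclideanSpace ℝ (Fin 3) →L[ℝ] EuclideanSpace ℝ (Fin 3)) →L[ℝ] ℝ)‖
    with hTn
  have hM₄0 : 0 ≤ M₄ := (norm_nonneg _).trans (hM₄ 0)
  have hE0 : 0 ≤ E₀ := (integral_nonneg fun y => sq_nonneg _).trans hE
  -- the source and its first two derivatives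
  have hS : ∀ k ≤ 2, ∀ y, ‖iteratedFDeriv ℝ k (pressureSource v) y‖ ≤
      Tn * ((1 + Tn) * (2 ^ (k + 1) * B ^ 2)) := fun k hk y =>
    norm_iteratedFDeriv_pressureSource_le hv k hB0 y (fun j hj => hB j (by omega) y)
  have hS0 : ∀ y, ‖pressureSource v y‖ ≤ Tn * ((1 + Tn) * (2 ^ 1 * B ^ 2)) := fun y => by
    rw [← norm_iteratedFDeriv_zero (𝕜 := ℝ) (f := pressureSource v)]; exact hS 0 (by norm_num) y
  have hS1 : ∀ y, ‖fderiv ℝ (pressureSource v) y‖ ≤ Tn * ((1 + Tn) * (2 ^ 2 * B ^ 2)) := fun y => by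
    rw [← norm_iteratedFDeriv_one (𝕜 := ℝ)]; exact hS 1 (by norm_num) y
  have hS2 : ∀ y, ‖fderiv ℝ (fderiv ℝ (pressureSource v)) y‖ ≤ Tn * ((1 + Tn) * (2 ^ 3 * B ^ 2)) :=
    fun y => by
    rw [← norm_iteratedFDeriv_one (f := fderiv ℝ (pressureSource v)), norm_iteratedFDeriv_fderiv]
    exact hS 2 le_rfl y
  -- near part
  have hnear : ‖iteratedFDeriv ℝ 2 (nearPotential 1 2 v) x‖ ≤
      newtonNearMass * (Tn * ((1 + Tn) * (2 ^ 3 * B ^ 2))) :=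
    (apexRieszPressure_nearBounds v hv x _ _ _ (fun z _ => hS0 _) (fun z _ => hS1 _)
      (fun z _ => hS2 _)).2.2
  -- far part
  have hfar : ‖iteratedFDeriv ℝ 2 (farPotential 1 2 v) x‖ ≤ M₄ * E₀ := by
    rw [← norm_iteratedFDeriv_fderiv, norm_iteratedFDeriv_one]
    refine ContinuousLinearMap.opNorm_le_bound₂ _ (mul_nonneg hM₄0 hE0) fun a b => ?_
    rw [fderiv_fderiv_farPotential_apply_apply one_pos one_lt_two hv.continuous hL2 x a b]
    have hbd : ∀ y, ‖fderiv ℝ (fderiv ℝ (fderiv ℝ (fderiv ℝ (newtonFar (1 : ℝ) 2)))) (x - y) a b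
        (v y) (v y)‖ ≤ M₄ * ‖a‖ * ‖b‖ * ‖v y‖ ^ 2 := fun y => by
      calc ‖fderiv ℝ (fderiv ℝ (fderiv ℝ (fderiv ℝ (newtonFar (1 : ℝ) 2)))) (x - y) a b (v y) (v y)‖
          ≤ ‖fderiv ℝ (fderiv ℝ (fderiv ℝ (fderiv ℝ (newtonFar (1 : ℝ) 2)))) (x - y) a b (v y)‖ *
              ‖v y‖ := ContinuousLinearMap.le_opNorm _ _
        _ ≤ ‖fderiv ℝ (fderiv ℝ (fderiv ℝ (fderiv ℝ (newtonFar (1 : ℝ) 2)))) (x - y) a b‖ *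
              ‖v y‖ * ‖v y‖ := by gcongr; exact ContinuousLinearMap.le_opNorm _ _
        _ ≤ ‖fderiv ℝ (fderiv ℝ (fderiv ℝ (fderiv ℝ (newtonFar (1 : ℝ) 2)))) (x - y) a‖ * ‖b‖ *
              ‖v y‖ * ‖v y‖ := by gcongr; exact ContinuousLinearMap.le_opNorm _ _
        _ ≤ ‖fderiv ℝ (fderiv ℝ (fderiv ℝ (fderiv ℝ (newtonFar (1 : ℝ) 2)))) (x - y)‖ * ‖a‖ *
              ‖b‖ * ‖v y‖ * ‖v y‖ := by gcongr; exact ContinuousLinearMap.le_opNorm _ _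
        _ ≤ M₄ * ‖a‖ * ‖b‖ * ‖v y‖ * ‖v y‖ := by gcongr; exact hM₄ _
        _ = M₄ * ‖a‖ * ‖b‖ * ‖v y‖ ^ 2 := by ring
    calc ‖∫ y, fderiv ℝ (fderiv ℝ (fderiv ℝ (fderiv ℝ (newtonFar (1 : ℝ) 2)))) (x - y) a b (v y) (v y)‖
        ≤ ∫ y, M₄ * ‖a‖ * ‖b‖ * ‖v y‖ ^ 2 :=
          norm_integral_le_of_norm_le (hL2.const_mul _) (Eventually.of_forall hbd)
      _ = M₄ * ‖a‖ * ‖b‖ * ∫ y, ‖v y‖ ^ 2 := integral_const_mul _ _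
      _ ≤ M₄ * ‖a‖ * ‖b‖ * E₀ := by gcongr
      _ = M₄ * E₀ * ‖a‖ * ‖b‖ := by ring
  -- assemble
  have h4 : ContDiff ℝ 4 v := hv.of_le (by norm_cast)
  have hn2 : ContDiff ℝ 2 (nearPotential 1 2 v) :=
    contDiff_nearPotential zero_le_one one_lt_two 2 (by exact_mod_cast h4)
  have hf2 : ContDiff ℝ 2 (farPotential 1 2 v) :=
    (contDiff_farPotential one_pos one_lt_two hv.continuous hL2).1
  have e : pressurePotential v = (-nearPotential 1 2 v) - farPotential 1 2 v := by
    funext y; simp only [pressurePotential, Pi.sub_apply, Pi.neg_apply]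
  rw [e, iteratedFDeriv_sub_apply (by exact hn2.neg.contDiffAt) (by exact hf2.contDiffAt),
    iteratedFDeriv_neg_apply]
  calc ‖-iteratedFDeriv ℝ 2 (nearPotential 1 2 v) x - iteratedFDeriv ℝ 2 (farPotential 1 2 v) x‖
      ≤ ‖-iteratedFDeriv ℝ 2 (nearPotential 1 2 v) x‖ + ‖iteratedFDeriv ℝ 2 (farPotential 1 2 v) x‖ :=
        norm_sub_le _ _
    _ ≤ _ := by rw [norm_neg]; exact add_le_add hnear hfar

end Summit.NavierStokesRegularity.NavierStokesRegularity.Theorems.AdaptedFrequencyConverges.UnsteadinessSqueeze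

end
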